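import Summits.CriticalPhenomena.SAWScalingLimit.Theorems.SAWRenewalTightnessRoomPassageEvents
import Summits.CriticalPhenomena.SAWScalingLimit.Theses.SAWLaplacianWalk
import Summits.CriticalPhenomena.SAWScalingLimit.Theorems.SubseqIdentification.Negative.ReversalLattice
import Summits.CriticalPhenomena.SAWScalingLimit.Theorems.SubseqIdentification.Negative.Necessity
import Literature.Probability.RandomPlanarGeometry.PolylineDyadicClock
import HarnessLib

/-!
# No return to the root along describable mesh sequences
(crux `SubseqIdentification`, stmt-CriticalPhenomena-0783; line `room-entropy-wright-fisher`, stub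
`stub_sawNoReturn` of the r7 skeleton
`Cruxes/SubseqIdentification/Lines/room_entropy_wright_fisher.lean`, continuation seat c1)

Hypothesis (C0) of the r7 driver statement and of the assembly of the line: along a mesh sequence
`s n → 0⁺` with SAW curve laws converging weakly to a probability law `μ` (`WeakLimitAlong`), the
self-avoiding walk does not come back within `r` of the root `a = D.pt 0` after having been at
distance `≥ R` from it, except with probability `≤ ε` for all large `n` (`NoReturnAlong`). This file
PROVES it from the shared route item `SAWLaplacianWalk.LimitsDescribable` (taken by name as a
hypothesis, exactly as in the skeleton):

1. *Reversal.* The SAW law of `(Ω_δ; b_δ, a_δ)` is the time reversal of that of `(Ω_δ; a_δ, b_δ)`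
   (`Negative.integral_curve_law_swap`, LSW 2004 §3.1), so `reverse_* μ` is a weak limit of the SAW
   curve laws of the swapped Dobrushin domain `D.swap = (D; b, a)` (`weakLimitAlong_swap`), to
   which `LimitsDescribable` applies: `μ`-a.e. class, reversed, is Loewner-describable in `D.swap`
   from `b`.
2. *A described class reaches its target only at the final time.* A described class is the
   time-compactified image `s ↦ Φ(γ(s/(1-s)))`, `1 ↦ target`, of a half-plane curve `γ ⊆ ℍ̄` under
   the boundary extension `Φ` of a chordal uniformizing map, and `Φ` omits the target on `ℍ̄`
   (`boundaryExtension_ne_pt_one`, Carathéodory). Hence `μ`-a.e. class has a representative visiting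
   `a` only at time `0`, and the exact-return event `⋂ᵣ E(R, r)`,
   `E(R, r) = {∃ u ≤ v, R ≤ |c(u) − a|, |c(v) − a| ≤ r}`, is `μ`-null
   (`measure_iInter_returnEvent_eq_zero`; compactness of `[0,1]²`).
3. *The return events are closed* in the space of curves modulo reparametrisation
   (`isClosed_returnCurves`, `isClosed_returnEvent`: approximate witnesses pass to the limit
   along `ε`-close reparametrisations, Aizenman–Burchard 1999 §2.1), contain the image of the
   lattice event `noReturnEvent` (the vertices are points of the polyline, reached at the dyadic
   times in order, `toCurve_apply_dyadicTime`), and decrease to the null event as `r ↓ 0`;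
   continuity from above and the closed-set half of the portmanteau theorem (Mathlib
   `FiniteMeasure.limsup_measure_closed_le_of_tendsto`) give `P_{s n}(noReturnEvent) ≤ ε` for
   large `n`.

References: G. F. Lawler, O. Schramm, W. Werner, *On the scaling limit of planar self-avoiding
walk*, Proc. Sympos. Pure Math. 72 (2004), §3.1 (reversal symmetry of `x_c^{|ω|}`);
A. Kemppainen, S. Smirnov, Ann. Probab. 45 (2017), §1.2, Thm. 1.5 (describable subsequential
limits); Ch. Pommerenke, *Boundary Behaviour of Conformal Maps* (1992), Thm. 2.6; P. Billingsley,
*Convergence of Probability Measures* (1999), Thm. 2.1 (portmanteau); M. Aizenman, A. Burchard,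
Duke Math. J. 99 (1999), §2.1.
-/

noncomputable section

open MeasureTheory Filter Topology Set
open scoped NNReal ENNReal Classical BigOperators unitInterval
open Literature.Probability.LatticeModels
open Literature.Probability.RandomPlanarGeometry
open UpperHalfPlane (upperHalfPlaneSet)
open Summit.CriticalPhenomena.SAWScalingLimit.Theses.SAWLaplacianWalk (LimitsDescribable)

namespace Summit.CriticalPhenomena.SAWScalingLimit.Theorems.SubseqIdentification.RoomEntropy

/-! ## The return event on parametrised curves

The event is written inline throughout (no new definitions in a Theorems file):
`{γ : Curve ℂ | ∃ u v : I, u ≤ v ∧ R ≤ dist (γ u) p ∧ dist (γ v) p ≤ r}` — "the curve is `R`-far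
from `p` at some time and `r`-close to `p` at a later time" — and its image under
`CurveClass.mk`. -/

/-- **Approximate witnesses pass to the limit** (compactness of `[0,1]²` and continuity of the
curve): if a fixed curve `γ` has, for every `n`, times `u n ≤ v n` with `R - e n ≤ dist (γ (u n)) p`
and `dist (γ (v n)) p ≤ r + e n`, where `e n → 0`, then `γ` is `R`-far from `p` at some time and
`r`-close at a later time. [folklore] -/
theorem mem_returnCurves_of_approx {γ : Curve ℂ} {p : ℂ} {R r : ℝ} {e : ℕ → ℝ}
    (he : Tendsto e atTop (𝓝 0)) (u v : ℕ → I) (huv : ∀ n, u n ≤ v n)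
    (hR : ∀ n, R - e n ≤ dist (γ (u n)) p) (hr : ∀ n, dist (γ (v n)) p ≤ r + e n) :
    γ ∈ {γ : Curve ℂ | ∃ u v : I, u ≤ v ∧ R ≤ dist (γ u) p ∧ dist (γ v) p ≤ r} := by
  obtain ⟨⟨u₀, v₀⟩, ψ, hψ, hlim⟩ := CompactSpace.tendsto_subseq fun n => (u n, v n)
  have hu : Tendsto (fun n => u (ψ n)) atTop (𝓝 u₀) := (continuous_fst.tendsto _).comp hlim
  have hv : Tendsto (fun n => v (ψ n)) atTop (𝓝 v₀) := (continuous_snd.tendsto _).comp hlim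
  have hγc : Continuous fun t : I => dist (γ t) p := γ.continuous.dist continuous_const
  have heψ : Tendsto (fun n => e (ψ n)) atTop (𝓝 0) := he.comp hψ.tendsto_atTop
  refine ⟨u₀, v₀, le_of_tendsto_of_tendsto hu hv (Eventually.of_forall fun n => huv (ψ n)), ?_, ?_⟩
  · have h1 : Tendsto (fun n => dist (γ (u (ψ n))) p) atTop (𝓝 (dist (γ u₀) p)) :=
      (hγc.tendsto u₀).comp hu
    have h2 : Tendsto (fun n => R - e (ψ n)) atTop (𝓝 R) := by
      simpa using (tendsto_const_nhds (x := R)).sub heψ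
    exact le_of_tendsto_of_tendsto h2 h1 (Eventually.of_forall fun n => hR (ψ n))
  · have h1 : Tendsto (fun n => dist (γ (v (ψ n))) p) atTop (𝓝 (dist (γ v₀) p)) :=
      (hγc.tendsto v₀).comp hv
    have h2 : Tendsto (fun n => r + e (ψ n)) atTop (𝓝 r) := by
      simpa using (tendsto_const_nhds (x := r)).add heψ
    exact le_of_tendsto_of_tendsto h1 h2 (Eventually.of_forall fun n => hr (ψ n))

/-- **The return event is closed in the space of parametrised curves** (reparametrisation
pseudo-metric): along a convergent sequence `γₙ → γ` choose reparametrisations realising the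
distances up to `1/(n+1)` (Aizenman–Burchard 1999, §2.1, (2.2)); the pulled-back witnessing times of
`γₙ` are approximate witnesses for `γ`, and `mem_returnCurves_of_approx` applies. [folklore] -/
theorem isClosed_returnCurves (p : ℂ) (R r : ℝ) :
    IsClosed {γ : Curve ℂ | ∃ u v : I, u ≤ v ∧ R ≤ dist (γ u) p ∧ dist (γ v) p ≤ r} := by
  refine IsSeqClosed.isClosed fun c γ hc hcγ => ?_
  have hd : Tendsto (fun n => dist γ (c n)) atTop (𝓝 0) := by
    have h := (tendsto_iff_dist_tendsto_zero.1 hcγ)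
    simpa only [dist_comm] using h
  choose u v huv hR hr using hc
  have hφ : ∀ n : ℕ, ∃ φ : I ≃o I, dist γ.toContinuousMap ((c n).reparam φ).toContinuousMap <
      dist γ (c n) + 1 / ((n : ℝ) + 1) := fun n =>
    Curve.exists_dist_reparam_lt (lt_add_of_pos_right _ Nat.one_div_pos_of_nat)
  choose φ hφ using hφ
  have hclose : ∀ n (t : I),
      dist (γ ((φ n).symm t)) (c n t) < dist γ (c n) + 1 / ((n : ℝ) + 1) := by
    intro n t
    have h1 := ContinuousMap.dist_apply_le_dist (f := γ.toContinuousMap)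
      (g := ((c n).reparam (φ n)).toContinuousMap) (x := (φ n).symm t)
    simp only [Curve.coe_toContinuousMap, Curve.reparam_apply, OrderIso.apply_symm_apply] at h1
    exact h1.trans_lt (hφ n)
  refine mem_returnCurves_of_approx (e := fun n => dist γ (c n) + 1 / ((n : ℝ) + 1)) ?_
    (fun n => (φ n).symm (u n)) (fun n => (φ n).symm (v n)) (fun n => (φ n).symm.monotone (huv n))
    (fun n => ?_) (fun n => ?_)
  · simpa using hd.add tendsto_one_div_add_atTop_nhds_zero_nat
  · have h1 := hclose n (u n)
    have h2 := dist_triangle (c n (u n)) (γ ((φ n).symm (u n))) p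
    rw [dist_comm (c n (u n)) (γ _)] at h2
    linarith [hR n]
  · have h1 := hclose n (v n)
    have h2 := dist_triangle (γ ((φ n).symm (v n))) (c n (v n)) p
    linarith [hr n]

/-- **Membership of a class in the return event is membership of ANY representative**: closed
sets of the pseudo-metric space `Curve ℂ` are saturated for reparametrisation distance zero.
[folklore] -/
theorem mk_mem_returnEvent_iff {γ : Curve ℂ} {p : ℂ} {R r : ℝ} :
    CurveClass.mk γ ∈ CurveClass.mk ''
        {γ : Curve ℂ | ∃ u v : I, u ≤ v ∧ R ≤ dist (γ u) p ∧ dist (γ v) p ≤ r} ↔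
      γ ∈ {γ : Curve ℂ | ∃ u v : I, u ≤ v ∧ R ≤ dist (γ u) p ∧ dist (γ v) p ≤ r} := by
  refine ⟨?_, fun h => ⟨γ, h, rfl⟩⟩
  rintro ⟨γ', hγ', hmk⟩
  have h0 : dist γ γ' = 0 := by
    rw [dist_comm]
    exact CurveClass.mk_eq_mk_iff_dist_eq_zero.1 hmk
  rw [← (isClosed_returnCurves p R r).closure_eq, Metric.mem_closure_iff]
  exact fun ε hε => ⟨γ', hγ', by rwa [h0]⟩

/-- **The return event is closed in the space of curves modulo reparametrisation** (the metric
quotient map is closed, `SeparationQuotient.isClosedMap_mk`). [folklore] -/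
theorem isClosed_returnEvent (p : ℂ) (R r : ℝ) :
    IsClosed (CurveClass.mk ''
      {γ : Curve ℂ | ∃ u v : I, u ≤ v ∧ R ≤ dist (γ u) p ∧ dist (γ v) p ≤ r}) := by
  rw [CurveClass.mk_eq_separationQuotientMk]
  exact SeparationQuotient.isClosedMap_mk _ (isClosed_returnCurves p R r)

/-- The return event only shrinks when the return radius shrinks. [folklore] -/
theorem returnEvent_mono (p : ℂ) (R : ℝ) {r r' : ℝ} (h : r ≤ r') :
    CurveClass.mk '' {γ : Curve ℂ | ∃ u v : I, u ≤ v ∧ R ≤ dist (γ u) p ∧ dist (γ v) p ≤ r} ⊆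
      CurveClass.mk '' {γ : Curve ℂ | ∃ u v : I, u ≤ v ∧ R ≤ dist (γ u) p ∧ dist (γ v) p ≤ r'} := by
  rintro _ ⟨γ, ⟨u, v, huv, hR, hr⟩, rfl⟩
  exact ⟨γ, ⟨u, v, huv, hR, hr.trans h⟩, rfl⟩

/-! ## The lattice no-return event is a return event of the polyline -/

/-- **The polyline of a walk is at its `i`-th vertex at the `i`-th dyadic time** (`i ≤ length`;
`polylineFrom_apply_dyadicTime` read through `toCurve`). [folklore] -/
theorem toCurve_apply_dyadicTime {V E : Type*} [NormedAddCommGroup E] [NormedSpace ℝ E]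
    {G : SimpleGraph V} {u v : V} (emb : V → E) (w : G.Walk u v) {i : ℕ} (hi : i ≤ w.length) :
    w.toCurve emb (dyadicTime i) = emb (w.getVert i) := by
  have hsupp : w.support.map emb = emb u :: w.support.tail.map emb := by
    conv_lhs => rw [← w.cons_tail_support]
    rfl
  have hlen : i ≤ (w.support.tail.map emb).length := by
    rw [List.length_map, List.length_tail, SimpleGraph.Walk.length_support]
    simpa using hi
  have h1 : w.toCurve emb (dyadicTime i) =
      (polylineFrom (emb u) (w.support.tail.map emb)).2 (dyadicTime i) := by
    rw [SimpleGraph.Walk.toCurve, hsupp]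
    rfl
  rw [h1, polylineFrom_apply_dyadicTime (emb u) _ hlen, List.getElem_eq_iff, ← hsupp,
    List.getElem?_map, ← SimpleGraph.Walk.getVert_eq_support_getElem? w hi]
  rfl

/-- The polyline of a walk is at its `i`-th vertex (indices beyond the length read the last vertex,
as `getVert` does) at the dyadic time of index `min i length`. [folklore] -/
theorem toCurve_apply_dyadicTime_min {V E : Type*} [NormedAddCommGroup E] [NormedSpace ℝ E]
    {G : SimpleGraph V} {u v : V} (emb : V → E) (w : G.Walk u v) (i : ℕ) :
    w.toCurve emb (dyadicTime (min i w.length)) = emb (w.getVert i) := by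
  rw [toCurve_apply_dyadicTime emb w (min_le_right _ _)]
  rcases le_total i w.length with h | h
  · rw [min_eq_left h]
  · rw [min_eq_right h, w.getVert_of_length_le h, w.getVert_length]

/-- **The lattice no-return event lies in the return event of the curve**: the two vertices
witnessing `noReturnEvent` are points of the polyline reached at dyadic times in the same order.
[folklore] -/
theorem curve_mem_returnEvent_of_mem_noReturnEvent {D : DobrushinDomain} {δ : ℝ} {a b : Site 2}
    {R r : ℝ} {γ : SAW.DomainSAW D.carrier δ a b} (h : γ ∈ noReturnEvent D δ a b R r) :
    γ.curve ∈ CurveClass.mk ''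
      {c : Curve ℂ | ∃ u v : I, u ≤ v ∧ R ≤ dist (c u) (D.pt 0) ∧ dist (c v) (D.pt 0) ≤ r} := by
  obtain ⟨i, k, hik, hR, hr⟩ := h
  refine ⟨⟨γ.walk.toCurve (meshPoint δ)⟩, ⟨dyadicTime (min i γ.walk.length),
    dyadicTime (min k γ.walk.length), dyadicTime_mono (min_le_min_right _ hik.le), ?_, ?_⟩, rfl⟩
  · change R ≤ dist (γ.walk.toCurve (meshPoint δ) (dyadicTime (min i γ.walk.length))) (D.pt 0)
    rwa [toCurve_apply_dyadicTime_min]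
  · change dist (γ.walk.toCurve (meshPoint δ) (dyadicTime (min k γ.walk.length))) (D.pt 0) ≤ r
    rwa [toCurve_apply_dyadicTime_min]

/-! ## The reversed weak limit and the describability of its classes -/

/-- **The reversed weak limit**: if the SAW curve laws of `(D; a, b)` converge weakly to `μ` along
`s n`, those of the swapped domain `(D; b, a)` converge weakly to `reverse_* μ` (exact lattice
reversibility `Negative.integral_curve_law_swap` and continuity of `CurveClass.reverse`).
[folklore] -/
theorem weakLimitAlong_swap {D : DobrushinDomain} {a b : ℝ → Site 2} {μ : Measure (CurveClass ℂ)}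
    {s : ℕ → ℝ} (h : WeakLimitAlong D a b μ s) :
    WeakLimitAlong D.swap b a (μ.map CurveClass.reverse) s := by
  intro f
  change Tendsto (fun n => ∫ γ, f γ.curve ∂(SAW.law D.carrier (s n) (b (s n)) (a (s n)))) atTop
    (𝓝 (∫ x, f x ∂(μ.map CurveClass.reverse)))
  rw [integral_map CurveClass.measurable_reverse.aemeasurable f.continuous.aestronglyMeasurable]
  simp_rw [Negative.integral_curve_law_swap]
  exact h (f.compContinuous ⟨CurveClass.reverse, CurveClass.continuous_reverse⟩)

/-- **`μ`-a.e. class, reversed, is Loewner-describable in the swapped domain** (`LimitsDescribable`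
at `(D.swap; b, a)`, the swapped endpoint approximation `Negative.isEndpointApprox_swap`, a chordal
uniformizing map `φ` of `D.swap` and the reversed weak limit). [folklore] -/
theorem ae_isLoewnerDescribable_reverse (hLD : LimitsDescribable) {D : DobrushinDomain}
    {a b : ℝ → Site 2} (hab : SAW.IsEndpointApprox D a b) {μ : Measure (CurveClass ℂ)}
    [IsProbabilityMeasure μ] {s : ℕ → ℝ} (hs : Tendsto s atTop (𝓝[>] (0 : ℝ)))
    (hlim : WeakLimitAlong D a b μ s) {φ : ConformalEquiv upperHalfPlaneSet D.swap.carrier}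
    (hφ : D.swap.IsChordalUniformizing φ) :
    ∀ᵐ c ∂μ, IsLoewnerDescribable (D := D.swap) φ c.reverse := by
  have h := hLD D.swap b a (Negative.isEndpointApprox_swap hab) φ hφ (μ.map CurveClass.reverse)
    inferInstance ⟨s, hs, weakLimitAlong_swap hlim⟩
  exact (CurveClass.ae_map_reverse_iff.1 h).mono fun c hc => hc.1

/-- **The exact-return event is `μ`-null.** A class whose reversal is described in `(D; b, a)` has
a representative `s ↦ Φ(γ((1-s)/s))` (`s > 0`), `0 ↦ a`, with `γ ⊆ ℍ̄` and `Φ` the boundary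
extension of a chordal uniformizing map of `D.swap`, which omits `a = D.swap.pt 1` on `ℍ̄`
(`boundaryExtension_ne_pt_one`); so it visits `a` only at time `0`, whereas a class in every
`E(R, 1/(m+1))` has (saturation `mk_mem_returnEvent_iff` + compactness `mem_returnCurves_of_approx`)
times `u ≤ v` with `R ≤ |c(u) − a|` and `c(v) = a`, forcing `v > 0`. [folklore] -/
theorem measure_iInter_returnEvent_eq_zero (hLD : LimitsDescribable) {D : DobrushinDomain}
    {a b : ℝ → Site 2} (hab : SAW.IsEndpointApprox D a b) {μ : Measure (CurveClass ℂ)}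
    [IsProbabilityMeasure μ] {s : ℕ → ℝ} (hs : Tendsto s atTop (𝓝[>] (0 : ℝ)))
    (hlim : WeakLimitAlong D a b μ s) {R : ℝ} (hR : 0 < R) :
    μ (⋂ m : ℕ, CurveClass.mk '' {γ : Curve ℂ | ∃ u v : I, u ≤ v ∧ R ≤ dist (γ u) (D.pt 0) ∧
      dist (γ v) (D.pt 0) ≤ 1 / ((m : ℝ) + 1)}) = 0 := by
  obtain ⟨φ, hφ⟩ := MarkedDomain.exists_isChordalUniformizing_holds D.swap
  rw [measure_eq_zero_iff_ae_notMem]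
  filter_upwards [ae_isLoewnerDescribable_reverse hLD hab hs hlim hφ] with c hc hmem
  obtain ⟨W, -, γH, hgen, c', hc', hcomp⟩ := hc
  have hrep : c = CurveClass.mk c'.reverse := by
    rw [← CurveClass.reverse_mk, ← hc', CurveClass.reverse_reverse]
  rw [Set.mem_iInter] at hmem
  have hF : ∀ m : ℕ, c'.reverse ∈ {γ : Curve ℂ | ∃ u v : I, u ≤ v ∧ R ≤ dist (γ u) (D.pt 0) ∧
      dist (γ v) (D.pt 0) ≤ 1 / ((m : ℝ) + 1)} := fun m =>
    mk_mem_returnEvent_iff.1 (hrep ▸ hmem m)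
  choose u v huv hRm hrm using hF
  obtain ⟨u₀, v₀, huv₀, hR₀, hr₀⟩ := mem_returnCurves_of_approx (γ := c'.reverse) (p := D.pt 0)
    (R := R) (r := 0) (e := fun m : ℕ => 1 / ((m : ℝ) + 1)) tendsto_one_div_add_atTop_nhds_zero_nat
    u v huv (fun m => by linarith [hRm m, Nat.one_div_pos_of_nat (α := ℝ) (n := m)])
    (fun m => by simpa using hrm m)
  have hv₀ : c'.reverse v₀ = D.pt 0 := dist_le_zero.1 hr₀
  by_cases h0 : v₀ = 0
  · have hu₀ : u₀ = 0 := le_antisymm (h0 ▸ huv₀) bot_le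
    rw [hu₀, ← h0, hv₀, dist_self] at hR₀
    exact absurd hR₀ (not_le.2 hR)
  · have hpos : (0 : ℝ) < v₀ := lt_of_le_of_ne v₀.2.1 fun h => h0 (Subtype.ext h.symm)
    have hlt : ((σ v₀ : I) : ℝ) < 1 := by
      rw [unitInterval.coe_symm_eq]
      linarith
    have h1 := hcomp.1 (σ v₀) hlt
    have him : 0 ≤ (γH (rayParam (σ v₀))).im := hgen.2.2.1 _
    have hne := boundaryExtension_ne_pt_one hφ (mem_closure_upperHalfPlaneSet_iff.2 him)
    rw [MarkedDomain.pt_swap_one] at hne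
    exact hne (h1 ▸ hv₀)

/-! ## Portmanteau along the mesh sequence -/

/-- **Closed-set half of the portmanteau theorem along the mesh sequence**: if the curve laws
converge weakly to `μ` along `s n` and a closed event `E` of curve space has `μ E < η`, then for
large `n` the SAW law charges `{curve ∈ E}` by `< η` (the laws are probability measures or `0`,
`Negative.isProbabilityMeasure_law_or_eq_zero`, so Mathlib's finite-measure portmanteau
`FiniteMeasure.limsup_measure_closed_le_of_tendsto` applies to the push-forwards). [folklore] -/
theorem eventually_law_curve_mem_lt {D : DobrushinDomain} {a b : ℝ → Site 2}
    {μ : Measure (CurveClass ℂ)} [IsProbabilityMeasure μ] {s : ℕ → ℝ}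
    (hlim : WeakLimitAlong D a b μ s) {E : Set (CurveClass ℂ)} (hE : IsClosed E) {η : ℝ≥0∞}
    (hμE : μ E < η) :
    ∀ᶠ n in atTop, SAW.law D.carrier (s n) (a (s n)) (b (s n)) {γ | γ.curve ∈ E} < η := by
  have hfin : ∀ n, IsFiniteMeasure (SAW.law D.carrier (s n) (a (s n)) (b (s n))) := fun n => by
    rcases Negative.isProbabilityMeasure_law_or_eq_zero D.carrier (s n) (a (s n)) (b (s n)) with
      h | h
    · infer_instance
    · rw [h]; infer_instance
  set P : ℕ → FiniteMeasure (CurveClass ℂ) := fun n =>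
    ⟨(SAW.law D.carrier (s n) (a (s n)) (b (s n))).map fun γ => γ.curve, inferInstance⟩ with hP
  set ν : FiniteMeasure (CurveClass ℂ) := ⟨μ, inferInstance⟩ with hν
  have hT : Tendsto P atTop (𝓝 ν) := by
    rw [FiniteMeasure.tendsto_iff_forall_integral_tendsto]
    intro f
    have h1 : ∀ n, ∫ x, f x ∂(P n : Measure (CurveClass ℂ)) =
        ∫ γ, f γ.curve ∂(SAW.law D.carrier (s n) (a (s n)) (b (s n))) := fun n => by
      rw [hP, FiniteMeasure.toMeasure_mk]
      exact integral_map (SAW.DomainSAW.measurable_of_top _).aemeasurable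
        f.continuous.aestronglyMeasurable
    simp_rw [h1]
    exact hlim f
  have hls := FiniteMeasure.limsup_measure_closed_le_of_tendsto hT hE
  have hev := Filter.eventually_lt_of_limsup_lt (hls.trans_lt hμE)
  filter_upwards [hev] with n hn
  rw [hP, FiniteMeasure.toMeasure_mk,
    Measure.map_apply (SAW.DomainSAW.measurable_of_top _) hE.measurableSet] at hn
  exact hn

/-! ## The stub -/

/-- **No return to the root along describable mesh sequences** (`LimitsDescribable → SAWNoReturn`,
stub `stub_sawNoReturn` of the line `room-entropy-wright-fisher`): for every Dobrushin domain with
an endpoint approximation and every probability weak limit `μ` of the SAW curve laws along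
`s n → 0⁺`, for all `R, ε > 0` there is `r > 0` such that, for large `n`, the walk comes back within
`r` of `a` after having been at distance `≥ R` only with probability `≤ ε`. Proof: the return events
`E(R, 1/(m+1))` are closed and decrease to the `μ`-null exact-return event
(`measure_iInter_returnEvent_eq_zero`: reversal symmetry + describability in `D.swap` + "a described
class reaches its target only at the final time"), so `μ(E(R, r)) < ε` for some `r = 1/(m+1)`
(continuity from above), and the portmanteau theorem bounds the lattice probabilities of
`noReturnEvent ⊆ {curve ∈ E(R, r)}` for large `n`. [folklore] -/
theorem stub_sawNoReturn :
    LimitsDescribable →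
    ∀ (D : DobrushinDomain) (a b : ℝ → Site 2), SAW.IsEndpointApprox D a b →
      ∀ (μ : Measure (CurveClass ℂ)) (s : ℕ → ℝ), IsProbabilityMeasure μ →
        Tendsto s atTop (𝓝[>] (0 : ℝ)) → WeakLimitAlong D a b μ s → NoReturnAlong D a b s := by
  intro hLD D a b hab μ s hμ hs hlim R ε hR hε
  haveI := hμ
  set S : ℕ → Set (CurveClass ℂ) := fun m => CurveClass.mk '' {γ : Curve ℂ | ∃ u v : I, u ≤ v ∧
    R ≤ dist (γ u) (D.pt 0) ∧ dist (γ v) (D.pt 0) ≤ 1 / ((m : ℝ) + 1)} with hS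
  have hanti : Antitone S := fun m m' hmm' =>
    returnEvent_mono _ _ (one_div_le_one_div_of_le (by positivity)
      (by exact_mod_cast Nat.add_le_add_right hmm' 1))
  have h0 : μ (⋂ m, S m) = 0 := measure_iInter_returnEvent_eq_zero hLD hab hs hlim hR
  have htend : Tendsto (μ ∘ S) atTop (𝓝 0) := by
    rw [← h0]
    exact tendsto_measure_iInter_atTop
      (fun m => (isClosed_returnEvent _ _ _).measurableSet.nullMeasurableSet) hanti
      ⟨0, measure_ne_top _ _⟩
  have hεpos : (0 : ℝ≥0∞) < ENNReal.ofReal ε := ENNReal.ofReal_pos.2 hε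
  obtain ⟨m, hm⟩ := ((tendsto_order.1 htend).2 _ hεpos).exists
  refine ⟨1 / ((m : ℝ) + 1), Nat.one_div_pos_of_nat, ?_⟩
  filter_upwards [eventually_law_curve_mem_lt hlim
    (isClosed_returnEvent (D.pt 0) R (1 / ((m : ℝ) + 1))) hm] with n hn
  exact le_trans (measure_mono fun γ hγ => curve_mem_returnEvent_of_mem_noReturnEvent hγ) hn.le

end Summit.CriticalPhenomena.SAWScalingLimit.Theorems.SubseqIdentification.RoomEntropy

end
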